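import Literature.IUT.LogVolume.TensorPacketContentVolume
import Literature.IUT.LogVolume.TensorPacketShellHull
import Literature.IUT.LogVolume.TensorPacketMShellUnramified
import Literature.IUT.LogVolume.TensorPacketMShellTame
import HarnessLib

/-!
# The (Ind2)-orbit hull of a slot-union at a TAME / UNRAMIFIED packet: closed-form bound, exact value, and
# cross-field monotonicity at an unramified small side ([IUTchIV] Prop. 1.2 (ii)/(iv), Thm. 1.10 Step (v)–(vi))

abc-iut cell, prover seat abc-iut-w5-d036 (gen 5); G1-Θ hands item «(X)-tame» of abc-iut-w5-d166's
`HOME/staging/w5/w5-d166/g4/G1-THETA-SHAPES.md` §2/§4 (iii) (route α for the READ binder `hΘ` of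
`Conditional/AbcOfSShrink2.lean`: per summand, the normalised log-volume of the hull of the (Ind2)-orbit of the
(Ind1)-slot-union must not DECREASE when the local fields `F_{w_a}` are replaced by larger ones `K_{v̲_a}` carrying
Θ-values of the SAME norms). Sequel to abc-iut-w5-d082's `TensorPacketContentBounds` / `TensorPacketContentVolume`
(the window `log‖g_{i₁}‖ + δ_Λ ≤ log μ̄(hull(⋃_γ γ·M)) ≤ −⌊λ_min − d_I − a_I⌋·log p + log μ̄(hull(log_p(R_I^×)))`) and to
`TensorPacketMShellTame` / `TensorPacketMShellUnramified` (`d_i + a_i = 1` at a tame factor; `d_I = 0`, `a_I = |I|`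
at an odd unramified tuple). PROVED here, for a bounded region `M` with
`ι_{i₀}(g_{i₀})·(R_I)^∼ ⊆ M ⊆ ⋃_i ι_i(g_i)·(R_I)^∼` (`‖g_i‖ = p^{−m_i/e_i}`, `i₀` a slot of least order `λ_min`) and
`|I| ≥ 2`, `p > 2`:

* TAME closed form of the upper end (`packetLogμ_packetHull_orbit_le_of_tame`): every `e_i ≤ p − 2` ⇒
  `log μ̄(hull(⋃_γ γ·M)) ≤ (d_I − ⌊λ_min⌋)·log p` — [IUTchIV] Prop. 1.2 (ii) at `φ = id` plus Prop. 1.4 (iii)'s tame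
  evaluation `log μ̄(hull(log_p(R_I^×))) = −a_I·log p` and `d_I + a_I = |I|`;
* UNRAMIFIED EXACT VALUE (`packetLogμ_packetHull_orbit_eq_log_norm_of_unramified`): every `e_i = 1` ⇒
  **`log μ̄(hull(⋃_{γ∈Ind2} γ·M)) = log‖g_{i₀}‖ = −λ_min·log p`** — at an odd unramified tuple neither the (Ind1)
  slot-union, nor the (Ind2)-orbit, nor the holomorphic hull inflates the log-volume beyond the bare Θ-region of the
  slot of LEAST order (the kernel form, at unramified primes, of [IUTchIV] Prop. 1.2 (iv) "`φ((R_I)^∼) ⊆ (R_I)^∼`" /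
  Thm. 1.10 Step (vi) "precisely equal", and of the `λ_min` reading recorded in `HOME/plan/c312/STEPV-IND1-NOTE.md` §2);
  slot-union form `packetLogμ_packetHull_orbit_slotUnion_eq_of_unramified`;
* CROSS-FIELD MONOTONICITY AT AN UNRAMIFIED SMALL SIDE (`packetLogμ_packetHull_orbit_le_of_unramified_of_norm_eq`):
  for a second tuple of fields `k'_i` over the same index set (NO embedding `k_i → k'_i` is needed) and a bounded
  region `M' ⊇ ι'_{i₀}(g'_{i₀})·(R'_I)^∼` with `‖g'_{i₀}‖ = ‖g_{i₀}‖`: `log μ̄(hull(⋃_γ γ·M)) ≤ log μ̄'(hull'(⋃_{γ'} γ'·M'))`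
  — item (X) of the SHAPES memo at every prime `p > 2` UNRAMIFIED in the small fields, for ARBITRARY big fields.

HONEST SCOPE. The ramified-tame small side is NOT treated here: there the exact content involves the conductor of
`R_I = ⊗_{ℤ_p} R_i` in `(R_I)^∼` (for tame tuples `𝔣 = (Π_i 𝔡_i)·𝔇_{(R_I)^∼}^{−1}` by Gorenstein duality of the complete
intersection `R_I`, giving content `⌊λ_min + 1 − 1/e_L⌋ − |I|` with `e_L` the least ramification index among the
field factors of `V`), which the tree does not yet have; recorded for the G1-Θ lead, not used. Classical lattice
algebra over the tree's typings of (Ind1)/(Ind2)/the hull of the disputed corpus [claim: Mochizuki2012, status: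
disputed]; nothing here takes a side on [IUTchIII] Cor. 3.12; typed ≠ proved. PROOF-ONLY file: no definitions, no
named `Prop` facts. [cite: Mochizuki2012, IUTchIV Prop. 1.2 (ii)(iv) p. 10–11, Thm 1.10 proof Step (v)–(vi) p. 27–29]
[cite: DupuyHilado2025, §4.7, §4.9, §4.12]
-/

noncomputable section

open Set Module
open scoped Pointwise TensorProduct

namespace Literature.IUT.LogVolume

variable (p : ℕ) [Fact p.Prime]
variable {I : Type} [Fintype I] [DecidableEq I] [Nonempty I]
variable (k : I → Type) [∀ i, NontriviallyNormedField (k i)] [∀ i, NormedAlgebra ℚ_[p] (k i)]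
  [∀ i, IsUltrametricDist (k i)] [∀ i, ProperSpace (k i)]

/-! ## §1 Tame closed form of the upper end -/

omit [DecidableEq I] [Nonempty I] in
/-- `d_I + a_I = |I|` at a tame tuple (`p > 2`, every `e_i ≤ p − 2`; `d_i + a_i = 1` factorwise).
[cite: Mochizuki2012, IUTchIV Prop. 1.2 (ii) p. 10] -/
theorem dSum_add_aSum_eq_card_of_tame (hp : 2 < p) (he : ∀ i, absRamificationIdx p (k i) ≤ p - 2) :
    dSum p k + aSum p k = Fintype.card I := by
  rw [dSum, aSum, ← Finset.sum_add_distrib,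
    Finset.sum_congr rfl fun i _ => differentOrd_add_logRadiusA_eq_one_of_tame p hp (he i)]
  simp

omit [DecidableEq I] [Nonempty I] in
/-- `a_I = Σ_i 1/e_i` at a tame tuple (`a_i = 1/e_i` when `p > 2`, `e_i ≤ p − 2`).
[cite: Mochizuki2012, IUTchIV Prop. 1.2 p. 10] -/
theorem aSum_eq_sum_inv_of_tame (hp : 2 < p) (he : ∀ i, absRamificationIdx p (k i) ≤ p - 2) :
    aSum p k = ∑ i, 1 / (absRamificationIdx p (k i) : ℝ) := by
  unfold aSum
  refine Finset.sum_congr rfl fun i _ => ?_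
  rw [logRadiusA_eq hp (absRamificationIdx_pos p (k i)) (he i)]

/-- **Tame closed form of the upper end of the window**: at a tame tuple (`p > 2`, every `e_i ≤ p − 2`, `|I| ≥ 2`),
for a bounded region `M ⊄ {0}` inside `⋃_i ι_i(g_i)·(R_I)^∼` (`‖g_i‖ = p^{−m_i/e_i}`, `i₀` of least order
`λ_min = m_{i₀}/e_{i₀}`): `log μ̄(hull(⋃_{γ ∈ Ind2} γ·M)) ≤ (d_I − ⌊λ_min⌋)·log p` — the content bound
`m ≥ ⌊λ_min − d_I − a_I⌋ = ⌊λ_min⌋ − |I|` of [IUTchIV] Prop. 1.2 (ii) read through the exact orbit formula and the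
tame value `log μ̄(hull(log_p(R_I^×))) = −a_I·log p`. [cite: Mochizuki2012, IUTchIV Prop. 1.2 (ii) p. 10, Prop. 1.4 (iii) p. 13] -/
theorem packetLogμ_packetHull_orbit_le_of_tame (hI : 2 ≤ Fintype.card I) (hp : 2 < p)
    (he : ∀ i, absRamificationIdx p (k i) ≤ p - 2) {M : Set (PacketAlgebra p k)}
    (hMb : IsPsiBounded p k M) (hM0 : ∃ x ∈ M, x ≠ 0)
    (g : Π i, k i) (mexp : I → ℤ) (hg : ∀ i, ‖g i‖ = (p : ℝ) ^ (-((mexp i : ℝ) / absRamificationIdx p (k i))))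
    (i₀ : I) (hmin : ∀ i, (mexp i₀ : ℝ) / absRamificationIdx p (k i₀) ≤ (mexp i : ℝ) / absRamificationIdx p (k i))
    (hMU : M ⊆ ⋃ i, iota p k i (g i) • (normalizedPacket p k : Set (PacketAlgebra p k))) :
    packetLogμ p k (packetHull p k (⋃ γ : indTwo p k, γ • M)) ≤
      (dSum p k - ⌊(mexp i₀ : ℝ) / absRamificationIdx p (k i₀)⌋) * Real.log p := by
  have h := packetLogμ_packetHull_orbit_le p k hI hMb hM0 g mexp hg i₀ hmin hMU
  have hda := dSum_add_aSum_eq_card_of_tame p k hp he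
  have hvol : packetLogμ p k (packetHull p k (logPacket p k : Set (PacketAlgebra p k))) =
      -(aSum p k) * Real.log p := by
    rw [packetLogμ_packetHull_logPacket_eq_of_tame p k hp he, aSum_eq_sum_inv_of_tame p k hp he]
  have hfloor : ⌊(mexp i₀ : ℝ) / absRamificationIdx p (k i₀) - dSum p k - aSum p k⌋ =
      ⌊(mexp i₀ : ℝ) / absRamificationIdx p (k i₀)⌋ - (Fintype.card I : ℤ) := by
    rw [sub_sub, hda, Int.floor_sub_natCast]
  rw [hvol, hfloor] at h
  have hcast : ((⌊(mexp i₀ : ℝ) / absRamificationIdx p (k i₀)⌋ - (Fintype.card I : ℤ) : ℤ) : ℝ) =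
      (⌊(mexp i₀ : ℝ) / absRamificationIdx p (k i₀)⌋ : ℝ) - (Fintype.card I : ℝ) := by push_cast; ring
  rw [hcast] at h
  have hd : dSum p k = (Fintype.card I : ℝ) - aSum p k := by linarith
  rw [hd]
  linarith

/-! ## §2 The unramified exact value -/

/-- **Unramified exact value**: at an odd unramified tuple (`p > 2`, every `e_i = 1`, `|I| ≥ 2`), for a bounded
region `M` with `ι_{i₀}(g_{i₀})·(R_I)^∼ ⊆ M ⊆ ⋃_i ι_i(g_i)·(R_I)^∼` (`‖g_i‖ = p^{−m_i}`, `i₀` of least order):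
`log μ̄(hull(⋃_{γ ∈ Ind2} γ·M)) = log‖g_{i₀}‖` — the (Ind1) slot-union, the (Ind2)-orbit and the hull together do
not inflate the log-volume beyond the bare region of the slot of least order ([IUTchIV] Prop. 1.2 (iv)
"`φ((R_I)^∼) ⊆ (R_I)^∼`"; Thm. 1.10 Step (vi) "precisely equal"). [cite: Mochizuki2012, IUTchIV Prop. 1.2 (iv) p. 11, Thm 1.10 proof Step (vi) p. 29] -/
theorem packetLogμ_packetHull_orbit_eq_log_norm_of_unramified (hI : 2 ≤ Fintype.card I) (hp : 2 < p)
    (he : ∀ i, absRamificationIdx p (k i) = 1) {M : Set (PacketAlgebra p k)} (hMb : IsPsiBounded p k M)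
    (g : Π i, k i) (mexp : I → ℤ) (hg : ∀ i, ‖g i‖ = (p : ℝ) ^ (-((mexp i : ℝ) / absRamificationIdx p (k i))))
    (i₀ : I) (hmin : ∀ i, (mexp i₀ : ℝ) / absRamificationIdx p (k i₀) ≤ (mexp i : ℝ) / absRamificationIdx p (k i))
    (hMU : M ⊆ ⋃ i, iota p k i (g i) • (normalizedPacket p k : Set (PacketAlgebra p k)))
    (hgM : iota p k i₀ (g i₀) • (normalizedPacket p k : Set (PacketAlgebra p k)) ⊆ M) :
    packetLogμ p k (packetHull p k (⋃ γ : indTwo p k, γ • M)) = Real.log ‖g i₀‖ := by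
  have hg0 := slot_ne_zero_and_log_norm p k (hg i₀)
  have htame : ∀ i, absRamificationIdx p (k i) ≤ p - 2 := fun i => by rw [he i]; omega
  have hM0 : ∃ x ∈ M, x ≠ 0 := by
    refine ⟨iota p k i₀ (g i₀), hgM ⟨1, Subring.one_mem _, ?_⟩, (map_ne_zero (iota p k i₀)).mpr hg0.1⟩
    change iota p k i₀ (g i₀) * 1 = iota p k i₀ (g i₀)
    rw [mul_one]
  refine le_antisymm ?_ (packetLogμ_packetHull_orbit_ge_log_norm p k hMb hg0.1 hgM)
  have h := packetLogμ_packetHull_orbit_le_of_tame p k hI hp htame hMb hM0 g mexp hg i₀ hmin hMU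
  rw [dSum_eq_zero_of_unramified p k he] at h
  rw [hg0.2, he i₀]
  rw [he i₀] at h
  simp only [Nat.cast_one, div_one, Int.floor_intCast, zero_sub] at h ⊢
  simpa using h

/-- The same exact value in the exponent: `log μ̄(hull(⋃_{γ ∈ Ind2} γ·M)) = −λ_min·log p`, `λ_min = m_{i₀} ∈ ℤ`.
[cite: Mochizuki2012, IUTchIV Prop. 1.2 (iv) p. 11, Thm 1.10 proof Step (vi) p. 29] -/
theorem packetLogμ_packetHull_orbit_eq_neg_mul_log_of_unramified (hI : 2 ≤ Fintype.card I) (hp : 2 < p)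
    (he : ∀ i, absRamificationIdx p (k i) = 1) {M : Set (PacketAlgebra p k)} (hMb : IsPsiBounded p k M)
    (g : Π i, k i) (mexp : I → ℤ) (hg : ∀ i, ‖g i‖ = (p : ℝ) ^ (-((mexp i : ℝ) / absRamificationIdx p (k i))))
    (i₀ : I) (hmin : ∀ i, (mexp i₀ : ℝ) / absRamificationIdx p (k i₀) ≤ (mexp i : ℝ) / absRamificationIdx p (k i))
    (hMU : M ⊆ ⋃ i, iota p k i (g i) • (normalizedPacket p k : Set (PacketAlgebra p k)))
    (hgM : iota p k i₀ (g i₀) • (normalizedPacket p k : Set (PacketAlgebra p k)) ⊆ M) :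
    packetLogμ p k (packetHull p k (⋃ γ : indTwo p k, γ • M)) = -((mexp i₀ : ℝ) * Real.log p) := by
  rw [packetLogμ_packetHull_orbit_eq_log_norm_of_unramified p k hI hp he hMb g mexp hg i₀ hmin hMU hgM,
    (slot_ne_zero_and_log_norm p k (hg i₀)).2, he i₀]
  simp

/-! ### The (Ind1) slot-union `⋃_i ι_i(g_i)·(R_I)^∼` itself -/

/-- The slot-union `⋃_i ι_i(g_i)·(R_I)^∼` is bounded. [cite: DupuyHilado2025, §4.7, §4.12] -/
theorem isPsiBounded_iUnion_iota_smul_normalizedPacket (g : Π i, k i) :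
    IsPsiBounded p k (⋃ i, iota p k i (g i) • (normalizedPacket p k : Set (PacketAlgebra p k))) :=
  isPsiBounded_iUnion p k fun _ => isPsiBounded_smul_normalizedPacket p k _

/-- **Unramified exact value for the slot-union**: at an odd unramified tuple with `|I| ≥ 2`,
`log μ̄(hull(⋃_{γ ∈ Ind2} γ·⋃_i ι_i(g_i)·(R_I)^∼)) = log‖g_{i₀}‖` for a slot `i₀` of least order — the `λ_min` form
of [IUTchIV] Thm. 1.10 Step (v) at an unramified prime, EXACT (cf. `HOME/plan/c312/STEPV-IND1-NOTE.md` §2).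
[cite: Mochizuki2012, IUTchIV Prop. 1.2 (iv) p. 11, Thm 1.10 proof Step (v)–(vi) p. 27–29] [cite: DupuyHilado2025, §4.7] -/
theorem packetLogμ_packetHull_orbit_slotUnion_eq_of_unramified (hI : 2 ≤ Fintype.card I) (hp : 2 < p)
    (he : ∀ i, absRamificationIdx p (k i) = 1)
    (g : Π i, k i) (mexp : I → ℤ) (hg : ∀ i, ‖g i‖ = (p : ℝ) ^ (-((mexp i : ℝ) / absRamificationIdx p (k i))))
    (i₀ : I) (hmin : ∀ i, (mexp i₀ : ℝ) / absRamificationIdx p (k i₀) ≤ (mexp i : ℝ) / absRamificationIdx p (k i)) :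
    packetLogμ p k (packetHull p k
        (⋃ γ : indTwo p k, γ • ⋃ i, iota p k i (g i) • (normalizedPacket p k : Set (PacketAlgebra p k)))) =
      Real.log ‖g i₀‖ :=
  packetLogμ_packetHull_orbit_eq_log_norm_of_unramified p k hI hp he
    (isPsiBounded_iUnion_iota_smul_normalizedPacket p k g) g mexp hg i₀ hmin Subset.rfl
    (subset_iUnion (fun i => iota p k i (g i) • (normalizedPacket p k : Set (PacketAlgebra p k))) i₀)

/-! ## §3 Cross-field monotonicity at an unramified small side -/

section CrossField

variable (k' : I → Type) [∀ i, NontriviallyNormedField (k' i)] [∀ i, NormedAlgebra ℚ_[p] (k' i)]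
  [∀ i, IsUltrametricDist (k' i)] [∀ i, ProperSpace (k' i)]

/-- **Cross-field monotonicity at an unramified small side** (item (X) of the G1-Θ SHAPES memo at every prime
`p > 2` unramified in the small fields): two tuples of fields `k_i`, `k'_i` over the same index set `I`
(`|I| ≥ 2`), the `k_i` all UNRAMIFIED, the `k'_i` ARBITRARY; a bounded region `M` of the packet of the `k_i` with
`ι_{i₀}(g_{i₀})·(R_I)^∼ ⊆ M ⊆ ⋃_i ι_i(g_i)·(R_I)^∼` (`i₀` of least order) and a bounded region `M'` of the packet of the
`k'_i` containing the bare region `ι'_{i₀}(g'_{i₀})·(R'_I)^∼` of an element of the SAME norm `‖g'_{i₀}‖ = ‖g_{i₀}‖`.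
Then `log μ̄(hull(⋃_{γ ∈ Ind2} γ·M)) ≤ log μ̄'(hull'(⋃_{γ' ∈ Ind2'} γ'·M'))`: the small side is EXACTLY `log‖g_{i₀}‖`
(§2) and the big side is at least the log-volume of the bare region it contains. No embedding `k_i → k'_i` is used.
[cite: Mochizuki2012, IUTchIV Prop. 1.2 (iv) p. 11] [cite: DupuyHilado2025, §4.9, §4.12] -/
theorem packetLogμ_packetHull_orbit_le_of_unramified_of_norm_eq (hI : 2 ≤ Fintype.card I) (hp : 2 < p)
    (he : ∀ i, absRamificationIdx p (k i) = 1) {M : Set (PacketAlgebra p k)} (hMb : IsPsiBounded p k M)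
    (g : Π i, k i) (mexp : I → ℤ) (hg : ∀ i, ‖g i‖ = (p : ℝ) ^ (-((mexp i : ℝ) / absRamificationIdx p (k i))))
    (i₀ : I) (hmin : ∀ i, (mexp i₀ : ℝ) / absRamificationIdx p (k i₀) ≤ (mexp i : ℝ) / absRamificationIdx p (k i))
    (hMU : M ⊆ ⋃ i, iota p k i (g i) • (normalizedPacket p k : Set (PacketAlgebra p k)))
    (hgM : iota p k i₀ (g i₀) • (normalizedPacket p k : Set (PacketAlgebra p k)) ⊆ M)
    {M' : Set (PacketAlgebra p k')} (hMb' : IsPsiBounded p k' M') (g' : k' i₀) (hgg' : ‖g'‖ = ‖g i₀‖)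
    (hgM' : iota p k' i₀ g' • (normalizedPacket p k' : Set (PacketAlgebra p k')) ⊆ M') :
    packetLogμ p k (packetHull p k (⋃ γ : indTwo p k, γ • M)) ≤
      packetLogμ p k' (packetHull p k' (⋃ γ : indTwo p k', γ • M')) := by
  have hg0 := (slot_ne_zero_and_log_norm p k (hg i₀)).1
  have hg0' : g' ≠ 0 := fun h => by
    rw [h, norm_zero] at hgg'
    exact hg0 (norm_eq_zero.mp hgg'.symm)
  rw [packetLogμ_packetHull_orbit_eq_log_norm_of_unramified p k hI hp he hMb g mexp hg i₀ hmin hMU hgM, ← hgg']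
  exact packetLogμ_packetHull_orbit_ge_log_norm p k' hMb' hg0' hgM'

/-- **Cross-field monotonicity for the slot-unions**: at `p > 2`, `|I| ≥ 2`, the `k_i` unramified, the `k'_i`
arbitrary, and slot elements with `‖g'_i‖ = ‖g_i‖` for every `i`:
`log μ̄(hull(⋃_γ γ·⋃_i ι_i(g_i)·(R_I)^∼)) ≤ log μ̄'(hull'(⋃_{γ'} γ'·⋃_i ι'_i(g'_i)·(R'_I)^∼))` — the per-summand
comparison that route α of the G1-Θ memo asks for, at the primes unramified in the small fields.
[cite: Mochizuki2012, IUTchIV Prop. 1.2 (iv) p. 11, Thm 1.10 proof Step (v) p. 27–28] [cite: DupuyHilado2025, §4.7, §4.12] -/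
theorem packetLogμ_packetHull_orbit_slotUnion_le_of_unramified_of_norm_eq (hI : 2 ≤ Fintype.card I) (hp : 2 < p)
    (he : ∀ i, absRamificationIdx p (k i) = 1)
    (g : Π i, k i) (mexp : I → ℤ) (hg : ∀ i, ‖g i‖ = (p : ℝ) ^ (-((mexp i : ℝ) / absRamificationIdx p (k i))))
    (i₀ : I) (hmin : ∀ i, (mexp i₀ : ℝ) / absRamificationIdx p (k i₀) ≤ (mexp i : ℝ) / absRamificationIdx p (k i))
    (g' : Π i, k' i) (hgg' : ∀ i, ‖g' i‖ = ‖g i‖) :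
    packetLogμ p k (packetHull p k
        (⋃ γ : indTwo p k, γ • ⋃ i, iota p k i (g i) • (normalizedPacket p k : Set (PacketAlgebra p k)))) ≤
      packetLogμ p k' (packetHull p k'
        (⋃ γ : indTwo p k', γ • ⋃ i, iota p k' i (g' i) • (normalizedPacket p k' : Set (PacketAlgebra p k')))) :=
  packetLogμ_packetHull_orbit_le_of_unramified_of_norm_eq p k k' hI hp he
    (isPsiBounded_iUnion_iota_smul_normalizedPacket p k g) g mexp hg i₀ hmin Subset.rfl
    (subset_iUnion (fun i => iota p k i (g i) • (normalizedPacket p k : Set (PacketAlgebra p k))) i₀)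
    (isPsiBounded_iUnion_iota_smul_normalizedPacket p k' g') (g' i₀) (hgg' i₀)
    (subset_iUnion (fun i => iota p k' i (g' i) • (normalizedPacket p k' : Set (PacketAlgebra p k'))) i₀)

end CrossField

end Literature.IUT.LogVolume

end
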